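import Summits.BirchSwinnertonDyer.BirchSwinnertonDyer.Theses.SemiOrdinaryEisensteinDescent
import Summits.BirchSwinnertonDyer.BirchSwinnertonDyer.Theorems.WildThreeRankOneBSDpOfExactIndexManin
import Summits.BirchSwinnertonDyer.BirchSwinnertonDyer.Theorems.SchneiderFreeAdditiveX3UpperReceptacle
import Summits.BirchSwinnertonDyer.BirchSwinnertonDyer.Theorems.ClassRecordThreeStepLOfHalvesB
import Literature.NumberTheory.EllipticCurves.BSDHeegnerPointsGrossZagierProofs
import Literature.NumberTheory.EllipticCurves.KrizLi2019.SexticTwistBSDThreeDescent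
import Literature.NumberTheory.EllipticCurves.GlobalMinimalModelProofs
import Literature.NumberTheory.EllipticCurves.ModularCurveManinConstantProofs
import HarnessLib

/-!
# Crux E `WildSplitEisensteinInclusionAtThree` (stmt-BirchSwinnertonDyer-20479): its VALUE-AT-𝟙 RESIDUAL
# `E_𝟙` — what route SOED's kernel actually consumes — and the leaf `WAllExclAddWildRankOneSurj` from `E_𝟙`
# in place of E (cell `pub/bsd-wall`, width seat `bsd-wall-soed-p1-w3` g0, `--supports 20479`, helper)

The kernel `EisensteinKernelAtThree` (item 20485, closed by `semiOrdinaryEisensteinDescent_eisensteinKernelAtThree_proof`,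
bed-p3 g1) reads the Eisenstein inclusion `Ch_Λ(X_(∅,0))·R₀⟦T⟧ ⊆ (L)` (crux E, 20479) ONLY at the trivial
character: through `Supersingular.two_mul_valuation_le_of_mem_span`, i.e. through the norm inequality
`‖f(𝟙)‖₃ ≤ ‖L(𝟙)‖` for a generator `f` of `Ch_Λ(X_(∅,0))` (control: `f(𝟙) ≠ 0`). THIS FILE isolates that
residual:

* §1 (every prime `p`) `norm_constantCoeff_le_of_map_mem_span` — `ι(f) ∈ (L)` ⟹ `‖f(0)‖ ≤ ‖L(0)‖`;
  `two_mul_valuation_le_of_norm_constantCoeff_le` — the kernel's algebra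
  (`Supersingular.two_mul_valuation_le_of_mem_span`) with the membership hypothesis WEAKENED to the norm
  inequality of constant terms: `f(0) ≠ 0`, `‖f(0)‖ ≤ ‖L(0)‖`, `L(0) = u·y²` (`u ∈ R₀ˣ`, `y ∈ ℚ_p`) ⟹ `y ≠ 0`
  and `2·ord_p y ≤ ord_p f(0)`.
* §2 **`valueAtOne_of_wildSplitEisensteinInclusionAtThree`** — crux E ⟹ its value-at-𝟙 form `E_𝟙` (displayed
  as the conclusion: E's binders and torsion guard verbatim, conclusion «for every generator `f` of
  `Ch_Λ(X_(∅,0))`, `‖f(𝟙)‖₃ ≤ ‖L(𝟙)‖`»). `E_𝟙` is NOT a new definition or item — it is a displayed shape.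
* §3 **`wAllExclAddWildRankOneSurj_of_valueAtOne`** — `PublishedInputsWildThree → E_𝟙 → WildKolyvaginUpperAtThree →
  WildSplitWaldspurgerAtThree → WildSplitControlAtThree → WildRankZeroTwistAtThree → WildRankOneSurjNonTowerAtThree →
  WAllExclAddWildRankOneSurj`: the kernel's proof VERBATIM (bed-p3 g1) with the single Eisenstein step fed by
  `E_𝟙` through §1. READING (planning fact for the «split E» pen item, soed-p1 g0 / pss3): the weakest
  Eisenstein-side statement the route needs is the bottom-layer BDP-value bound `E_𝟙` — in index currency
  `ord₃#Ш(E/K)[3^∞] + 2·ord₃∏c_w… ≥ …`, the «lower bound on Ш by the Heegner index» — not the Λ-adic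
  inclusion; E ⟹ E_𝟙 (§2), and the leaf follows from E_𝟙 with the same partner cruxes (§3). Whether `E_𝟙`
  has an engine that E lacks is NOT claimed (at `p = 3`: no admissible primes, trace-zero Heegner tower,
  supercuspidal `π₃` — lead's census); the LEVER alone (inclusion up to `3^k`) does NOT give `E_𝟙`.

HONEST STATUS: no progress on E; every research input is an antecedent; no definition, no named fact, no
`sorry`; BSD is not proved for any curve. Supports, does not close, stmt-BirchSwinnertonDyer-20479.

References: [JetchevSkinnerWan2017] §7.4.1 (arXiv:1512.06894 p. 30); [Castella2018] Thm. 2.3, §5 (5.1)–(5.3);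
[GrossZagier1986] Thm. I.(6.3), V.§2; [FriedbergHoffstein1995] Thm. B; folklore (norms in `ℂ_p`).
-/

noncomputable section

open scoped Classical

set_option linter.dupNamespace false
set_option autoImplicit false

namespace Summit.BirchSwinnertonDyer.BirchSwinnertonDyer.Theorems.WildSplitEisensteinInclusionAtThreeValueAtOne

open WeierstrassCurve NumberField IsDedekindDomain Field PowerSeries
  Literature.NumberTheory.EllipticCurves
  Literature.NumberTheory.EllipticCurves.ModularForms
  Literature.NumberTheory.EllipticCurves.Rank1Residual
  Literature.NumberTheory.EllipticCurves.KrizLi2019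
  Summit.BirchSwinnertonDyer.Rank1Residual
  Summit.BirchSwinnertonDyer.Rank1Residual.Additive
  Summit.BirchSwinnertonDyer.Rank1Residual.X11b
  Summit.BirchSwinnertonDyer.Rank1Residual.X11b.AcSelmer
  Summit.BirchSwinnertonDyer.Rank1Residual.X11b.Halves
  Summit.BirchSwinnertonDyer.BirchSwinnertonDyer.Theses.SemiOrdinaryEisensteinDescent
  Summit.BirchSwinnertonDyer.BirchSwinnertonDyer.Theorems

/-! ### §1 The kernel's algebra with the membership weakened to a norm inequality at `T = 0` -/

section Algebra

variable (p : ℕ) [Fact p.Prime]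

/-- **E at a frame ⟹ E_𝟙 at the frame (algebra).** If the image of `f ∈ Λ` in `R₀⟦T⟧` lies in `(L)` then
`‖f(0)‖ ≤ ‖L(0)‖` in `ℂ_p`: `f = G·L` gives `f(0) = G(0)·L(0)` with `‖G(0)‖ ≤ 1`. [folklore] -/
theorem norm_constantCoeff_le_of_map_mem_span {f : IwasawaAlgebra p} {L : UnrSeries p}
    (hfL : PowerSeries.map (toUnr p) f ∈ Ideal.span {L}) :
    ‖((constantCoeff f : ℤ_[p]) : ℚ_[p])‖ ≤ ‖((constantCoeff L : unrIntegers p) : ℂ_[p])‖ := by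
  obtain ⟨G, hG⟩ := Ideal.mem_span_singleton'.mp hfL
  have hfac : algebraMap ℚ_[p] ℂ_[p] ((constantCoeff f : ℤ_[p]) : ℚ_[p]) =
      ((constantCoeff G : unrIntegers p) : ℂ_[p]) * ((constantCoeff L : unrIntegers p) : ℂ_[p]) := by
    rw [← coe_toUnr, ← CongruenceLimit.constantCoeff_map_apply (toUnr p) f, ← hG, map_mul, Subring.coe_mul]
  calc ‖((constantCoeff f : ℤ_[p]) : ℚ_[p])‖
      = ‖algebraMap ℚ_[p] ℂ_[p] ((constantCoeff f : ℤ_[p]) : ℚ_[p])‖ := (norm_algebraMap' ℂ_[p] _).symm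
    _ = ‖((constantCoeff G : unrIntegers p) : ℂ_[p])‖ * ‖((constantCoeff L : unrIntegers p) : ℂ_[p])‖ := by
        rw [hfac, norm_mul]
    _ ≤ 1 * ‖((constantCoeff L : unrIntegers p) : ℂ_[p])‖ :=
        mul_le_mul_of_nonneg_right (norm_coe_unrIntegers_le_one p _) (norm_nonneg _)
    _ = ‖((constantCoeff L : unrIntegers p) : ℂ_[p])‖ := one_mul _

/-- **The kernel's lower-socket algebra from `E_𝟙`.** If `f(0) ≠ 0` (CTL₀), `‖f(0)‖ ≤ ‖L(0)‖` (the
value-at-𝟙 residual of the Eisenstein inclusion) and `L(0) = u·y²` with `u ∈ R₀ˣ`, `y ∈ ℚ_p` (a value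
formula at `𝟙`), then `y ≠ 0` and `2·ord_p y ≤ ord_p f(0)` — `Supersingular.two_mul_valuation_le_of_mem_span`
with its hypothesis `ι(f) ∈ (L)` replaced by the norm inequality it was used for. [folklore] -/
theorem two_mul_valuation_le_of_norm_constantCoeff_le {f : IwasawaAlgebra p} (hf0 : constantCoeff f ≠ 0)
    {L : UnrSeries p}
    (hle : ‖((constantCoeff f : ℤ_[p]) : ℚ_[p])‖ ≤ ‖((constantCoeff L : unrIntegers p) : ℂ_[p])‖)
    (u : (unrIntegers p)ˣ) {y : ℚ_[p]}
    (hL : L.HasValueAt 0 (((u : unrIntegers p) : ℂ_[p]) * (algebraMap ℚ_[p] ℂ_[p] y) ^ 2)) :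
    y ≠ 0 ∧ 2 * y.valuation ≤ ((constantCoeff f).valuation : ℤ) := by
  have hL0 : ((u : unrIntegers p) : ℂ_[p]) * (algebraMap ℚ_[p] ℂ_[p] y) ^ 2 =
      ((constantCoeff L : unrIntegers p) : ℂ_[p]) :=
    UnrSeries.eq_constantCoeff_of_hasValueAt_zero hL
  have hnormf : ‖((constantCoeff f : ℤ_[p]) : ℚ_[p])‖ ≤ ‖y‖ ^ 2 := by
    calc ‖((constantCoeff f : ℤ_[p]) : ℚ_[p])‖
        ≤ ‖((constantCoeff L : unrIntegers p) : ℂ_[p])‖ := hle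
      _ = ‖algebraMap ℚ_[p] ℂ_[p] y‖ ^ 2 := by
          rw [← hL0, norm_mul, norm_pow, norm_coe_units_unrIntegers, one_mul]
      _ = ‖y‖ ^ 2 := by rw [norm_algebraMap']
  have hy0 : y ≠ 0 := by
    intro hy
    rw [hy, norm_zero, zero_pow two_ne_zero] at hnormf
    have h0 : ((constantCoeff f : ℤ_[p]) : ℚ_[p]) = 0 :=
      norm_eq_zero.mp (le_antisymm hnormf (norm_nonneg _))
    exact hf0 (PadicInt.coe_eq_zero.mp h0)
  refine ⟨hy0, Supersingular.two_mul_le_of_zpow_le p ?_⟩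
  rwa [← PadicInt.norm_def, PadicInt.norm_eq_zpow_neg_valuation hf0,
    Padic.norm_eq_zpow_neg_valuation hy0] at hnormf

end Algebra

/-! ### §2 Crux E ⟹ its value-at-𝟙 residual `E_𝟙` -/

/-- **E ⟹ E_𝟙.** Under crux E's binders and torsion guard VERBATIM, for every generator `f ∈ Λ` of
`Ch_Λ(X_(∅,0))`: `‖f(𝟙)‖₃ ≤ ‖L(𝟙)‖` — the Eisenstein inclusion read at the trivial character only
(`norm_constantCoeff_le_of_map_mem_span`). The displayed conclusion is the shape `E_𝟙` consumed by §3.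
[cite: JetchevSkinnerWan2017, §7.4.1 (arXiv:1512.06894 p. 30)] -/
theorem valueAtOne_of_wildSplitEisensteinInclusionAtThree (hE : WildSplitEisensteinInclusionAtThree) :
    ∀ (W : WeierstrassCurve ℚ) [W.IsElliptic] [W.IsGloballyMinimal] (N : ℕ) [NeZero N] (K : Type) [Field K] [NumberField K] (Dt : Literature.NumberTheory.EllipticCurves.ModularForms.ModularParametrizationData W N), Summit.BirchSwinnertonDyer.Rank1Residual.Additive.ClassO6 W 3 → W.HasSurjectiveModNGaloisRep 3 → W.analyticRank = 1 → W.conductorNorm ℤ = N → Literature.NumberTheory.EllipticCurves.IsImaginaryQuadratic K → Literature.NumberTheory.EllipticCurves.SatisfiesHeegnerHypothesis N K → ∀ (κ : Literature.NumberTheory.EllipticCurves.ZpExtension K 3), κ.IsAnticyclotomic → ∀ (γ : Field.absoluteGaloisGroup K) [Fact (κ.IsTopGenerator γ)] (𝔭 : IsDedekindDomain.HeightOneSpectrum (NumberField.RingOfIntegers K)), ((3 : ℕ) : NumberField.RingOfIntegers K) ∈ 𝔭.asIdeal → 𝔭.asIdeal.ramificationIdx (NumberField.RingOfIntegers ℚ)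 = 1 → 𝔭.asIdeal.inertiaDeg (NumberField.RingOfIntegers ℚ) = 1 → ∀ (𝔭' : IsDedekindDomain.HeightOneSpectrum (NumberField.RingOfIntegers K)), ((3 : ℕ) : NumberField.RingOfIntegers K) ∈ 𝔭'.asIdeal → 𝔭' ≠ 𝔭 → ∀ (ι' : PadicAlgCl 3 ≃+* ℂ), Summit.BirchSwinnertonDyer.BirchSwinnertonDyer.Theorems.SchneiderFree.BranchInducesPrime 3 ι' 𝔭 → ∀ (ΩK : ℂ) (Ωp : ℂ_[3]) (L : Literature.NumberTheory.EllipticCurves.UnrSeries 3), ΩK ≠ 0 → Ωp ≠ 0 → Literature.NumberTheory.EllipticCurves.IsBDPLFunction ι' 𝔭 κ γ Dt.f ΩK Ωp L → Module.IsTorsion (Literature.NumberTheory.EllipticCurves.IwasawaAlgebra 3) (Summit.BirchSwinnertonDyer.Rank1Residual.X11b.AcSelmer.XAc (W.baseChange K) 3 κ 𝔭' ∅ γ) → ∀ (f : Literature.NumberTheory.EllipticCurves.IwasawaAlgebra 3), Summit.BirchSwinnertonDyer.Rank1Residual.X11b.AcSelmer.XAc.charIdeal (W.baseChange K) 3 κ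 𝔭' ∅ γ = Ideal.span {f} → ‖((PowerSeries.constantCoeff f : ℤ_[3]) : ℚ_[3])‖ ≤ ‖((PowerSeries.constantCoeff L : Literature.NumberTheory.EllipticCurves.unrIntegers 3) : ℂ_[3])‖ := by
  intro W _ _ N _ K _ _ Dt hO6 hsurj hr1 hN hK hH κ hκ γ _ 𝔭 h𝔭 he hf 𝔭' h𝔭' hne ι' hι ΩK Ωp L hΩK hΩp hL htor
    f hfI
  have hincl := hE W N K Dt hO6 hsurj hr1 hN hK hH κ hκ γ 𝔭 h𝔭 he hf 𝔭' h𝔭' hne ι' hι ΩK Ωp L hΩK hΩp hL htor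
  rw [hfI, CongruenceLimit.map_span_singleton_powerSeries] at hincl
  exact norm_constantCoeff_le_of_map_mem_span 3 ((Ideal.span_singleton_le_iff_mem _).mp hincl)

/-! ### §3 The leaf from `E_𝟙` in place of E -/

/-- **SOED's leaf from the value-at-𝟙 residual.** `PublishedInputsWildThree → E_𝟙 → WildKolyvaginUpperAtThree →
WildSplitWaldspurgerAtThree → WildSplitControlAtThree → WildRankZeroTwistAtThree → WildRankOneSurjNonTowerAtThree →
WAllExclAddWildRankOneSurj` — the kernel `semiOrdinaryEisensteinDescent_eisensteinKernelAtThree_proof` (bed-p3 g1)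
VERBATIM except that the Eisenstein step is fed by `E_𝟙` (displayed hypothesis `hE1`, the shape of §2) through
`two_mul_valuation_le_of_norm_constantCoeff_le`. With §2: the kernel's use of crux E factors through `E_𝟙`.
Every crux is an antecedent; BSD is not proved by this.
[cite: JetchevSkinnerWan2017, §7.4.1 (arXiv:1512.06894 p. 30)] [cite: Castella2018, Thm. 2.3 and §5 (5.1)–(5.3)]
[cite: GrossZagier1986, Thm. I.(6.3) and V.§2] [cite: FriedbergHoffstein1995, Thm. B] -/
theorem wAllExclAddWildRankOneSurj_of_valueAtOne (hF : PublishedInputsWildThree)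
    (hE1 : ∀ (W : WeierstrassCurve ℚ) [W.IsElliptic] [W.IsGloballyMinimal] (N : ℕ) [NeZero N] (K : Type) [Field K] [NumberField K] (Dt : Literature.NumberTheory.EllipticCurves.ModularForms.ModularParametrizationData W N), Summit.BirchSwinnertonDyer.Rank1Residual.Additive.ClassO6 W 3 → W.HasSurjectiveModNGaloisRep 3 → W.analyticRank = 1 → W.conductorNorm ℤ = N → Literature.NumberTheory.EllipticCurves.IsImaginaryQuadratic K → Literature.NumberTheory.EllipticCurves.SatisfiesHeegnerHypothesis N K → ∀ (κ : Literature.NumberTheory.EllipticCurves.ZpExtension K 3), κ.IsAnticyclotomic → ∀ (γ : Field.absoluteGaloisGroup K) [Fact (κ.IsTopGenerator γ)] (𝔭 : IsDedekindDomain.HeightOneSpectrum (NumberField.RingOfIntegers K)), ((3 : ℕ) : NumberField.RingOfIntegers K) ∈ 𝔭.asIdeal → 𝔭.asIdeal.ramificationIdx (NumberField.RingOfIntegers ℚ) = 1 → 𝔭.asIdeal.inertiaDeg (NumberField.RingOfIntegers ℚ) = 1 → ∀ (𝔭' : IsDedekindDomain.HeightOneSpectrum (NumberField.RingOfIntegers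 K)), ((3 : ℕ) : NumberField.RingOfIntegers K) ∈ 𝔭'.asIdeal → 𝔭' ≠ 𝔭 → ∀ (ι' : PadicAlgCl 3 ≃+* ℂ), Summit.BirchSwinnertonDyer.BirchSwinnertonDyer.Theorems.SchneiderFree.BranchInducesPrime 3 ι' 𝔭 → ∀ (ΩK : ℂ) (Ωp : ℂ_[3]) (L : Literature.NumberTheory.EllipticCurves.UnrSeries 3), ΩK ≠ 0 → Ωp ≠ 0 → Literature.NumberTheory.EllipticCurves.IsBDPLFunction ι' 𝔭 κ γ Dt.f ΩK Ωp L → Module.IsTorsion (Literature.NumberTheory.EllipticCurves.IwasawaAlgebra 3) (Summit.BirchSwinnertonDyer.Rank1Residual.X11b.AcSelmer.XAc (W.baseChange K) 3 κ 𝔭' ∅ γ) → ∀ (f : Literature.NumberTheory.EllipticCurves.IwasawaAlgebra 3), Summit.BirchSwinnertonDyer.Rank1Residual.X11b.AcSelmer.XAc.charIdeal (W.baseChange K) 3 κ 𝔭' ∅ γ = Ideal.span {f} → ‖((PowerSeries.constantCoeff f : ℤ_[3]) : ℚ_[3])‖ ≤ ‖((PowerSeries.constantCoeff L : Literature.NumberTheory.EllipticCurves.unrIntegers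 3) : ℂ_[3])‖)
    (hKoly : WildKolyvaginUpperAtThree) (hV : WildSplitWaldspurgerAtThree) (hC : WildSplitControlAtThree)
    (hZ : WildRankZeroTwistAtThree) (hNT : WildRankOneSurjNonTowerAtThree) :
    Summit.BirchSwinnertonDyer.WAllExclAddWildRankOneSurj := by
  unfold Summit.BirchSwinnertonDyer.WAllExclAddWildRankOneSurj
  intro W _ _ hncm hO6 hsurj hr
  -- (o) TOWER SPLIT: off the tower-surjective rows the residual crux pays by name
  by_cases htower : AdditiveThree.TowerSurjThree W
  swap
  · exact hNT W hncm hO6 hsurj htower hr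
  obtain ⟨hGZ, hKo, hGZK, hmod, hmodP, -, hGZ73, hFH, hpar, hHP⟩ := hF
  haveI hN0 : NeZero (W.conductorNorm ℤ) := ⟨W.conductorNorm_pos_holds.ne'⟩
  -- (a) DATA. parity: `r_an = 1` is odd, so `w(E) = -1`
  have hw : W.rootNumber = -1 := by
    rcases W.rootNumber_eq_one_or with h | h
    · exfalso
      have heven : Even W.analyticRank := (hpar W).mpr h
      rw [hr] at heven
      exact Nat.not_even_one heven
    · exact h
  -- Friedberg–Hoffstein with auxiliary modulus `2`: Heegner for `N(E)` and `2` split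
  obtain ⟨K, _, _, hK, -, hHN, hH2, hLt⟩ := hFH W hw 2 two_ne_zero 0
  have hodd : Odd (NumberField.discr K) := by
    have h8 := Literature.SatisfiesHeegnerHypothesis.discr_emod_eight hK.1 hH2 (dvd_refl 2)
    rw [Int.odd_iff]; omega
  -- `3 ∣ N(E)` (additive) splits in `K`; hence `3 ∤ d_K`, `d_K ≠ -3`
  have h3N : 3 ∣ W.conductorNorm ℤ :=
    (W.dvd_conductorNorm_iff_not_hasGoodReductionAtPrime 3).mpr (not_good_of_addv W 3 hO6.2.1)
  have hsplit : SplitsIn K 3 := hHN 3 Nat.prime_three h3N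
  have hd3 : NumberField.discr K ≠ -3 := by
    intro h
    exact Literature.SatisfiesHeegnerHypothesis.not_dvd_discr hK.1 hHN Nat.prime_three h3N
      (by rw [h]; norm_num)
  -- the Heegner point over `K` and its data; non-torsion by Gross–Zagier
  obtain ⟨P, Dt, H, ι, hP⟩ := hHP W K hK hHN
  have hL0 : W.entireLFunction 1 = 0 := entireLFunction_one_eq_zero_of_analyticRank_eq_one hr
  obtain ⟨-, hderiv⟩ := leadingLCoeff_eq_deriv_of_analyticRank_eq_one hr
  have hLK : LDerivEK W K ≠ 0 := by
    rw [lDerivEK_eq_deriv_mul W K hmod hL0]; exact mul_ne_zero hderiv hLt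
  have hnt : ¬ IsOfFinAddOrder P :=
    (lDerivEK_ne_zero_iff_not_isOfFinAddOrder W (W.conductorNorm ℤ) K (hGZ _ W K) hK hHN
      ⟨Dt, H, ι, hP⟩).mp hLK
  -- Kolyvagin: `rank E(K) = 1`, `Ш(E/K)` finite
  obtain ⟨hrk, hfin⟩ := hKo (W.conductorNorm ℤ) W K hK hHN ⟨Dt, H, ι, hP⟩ hnt
  -- a frame `(κ, γ, 𝔭)` and the other prime `𝔭′ ≠ 𝔭` above `3`
  obtain ⟨κ, γ, -, hκ, hγ, -⟩ := X11b.exists_anticyclotomic_generator_prime (p := 3) hK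
  haveI : Fact (κ.IsTopGenerator γ) := ⟨hγ⟩
  obtain ⟨𝔭, h𝔭, he, hf⟩ := X11b.exists_degreeOnePrime_of_splitsIn K 3 hK.1 hsplit
  obtain ⟨𝔭', hne, h𝔭', he', hf'⟩ := X11b.Three.exists_ne_degreeOne_prime hK.1 h𝔭 he hf
  -- (b) PLUMBING. Waldspurger frame and unit value at `(κ, γ, 𝔭)`
  obtain ⟨ι', hind, ΩK, Ωp, L, hΩK, hΩp, hBDP, u, hval⟩ :=
    hV W (W.conductorNorm ℤ) K Dt H ι P hO6 hsurj hr rfl hK hHN hLt hP hnt κ hκ γ 𝔭 h𝔭 he hf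
  -- control count at `𝔭′` (CTL₀ included; supplies the torsion guard of the Eisenstein residual)
  have hctl : SchneiderFree.AdditiveControlOnTreeAt 3 κ 𝔭' γ (embAt K 3 𝔭' h𝔭' he' hf') P :=
    hC W (W.conductorNorm ℤ) K Dt H ι P hO6 hsurj hr rfl hK hHN hLt hP hnt (hKo _ W K) κ hκ γ 𝔭'
      h𝔭' he' hf'
  obtain ⟨n, hn, hneq⟩ := hctl
  -- the value read through the logarithm at `𝔭′` (rank one: `(log_{𝔭′} P)² = (log_𝔭 P)²`)
  have hval' : L.HasValueAt 0 ((((u : unrIntegers 3) : unrIntegers 3) : ℂ_[3]) *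
      (algebraMap ℚ_[3] ℂ_[3]
        (logOmega W 3 (embAt K 3 𝔭' h𝔭' he' hf') P / (Dt.c : ℚ_[3]))) ^ 2) :=
    (SchneiderFreeAdditiveX3.hasValueAt_sq_logOmega_embAt_iff_of_rank_one W 3 hK.1 hrk h𝔭 he hf
      h𝔭' he' hf' P _ _ L).mpr hval
  -- the LOWER socket at slack `v₃(c)` at the frame `(κ, 𝔭′, γ, embAt 𝔭′)` — from `E_𝟙`
  have hc0 : Dt.c ≠ 0 := Dt.maninConstant_ne_zero_holds
  have hlog : logOmega W 3 (embAt K 3 𝔭' h𝔭' he' hf') P ≠ 0 := X11b.R1.logOmega_ne_zero W 3 _ hnt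
  have hlow : SchneiderFree.AdditiveIMCLowerBDPOnTreeLeAt 3 κ 𝔭' γ (embAt K 3 𝔭' h𝔭' he' hf')
      (padicValNat 3 Dt.c.natAbs) P := by
    obtain ⟨htors, f, hfI, hf0, hfn⟩ := hn
    -- `E_𝟙` at the frame: `‖f(𝟙)‖₃ ≤ ‖L(𝟙)‖`
    have hle1 : ‖((constantCoeff f : ℤ_[3]) : ℚ_[3])‖ ≤ ‖((constantCoeff L : unrIntegers 3) : ℂ_[3])‖ :=
      hE1 W (W.conductorNorm ℤ) K Dt hO6 hsurj hr rfl hK hHN κ hκ γ 𝔭 h𝔭 he hf 𝔭' h𝔭' hne ι' hind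
        ΩK Ωp L hΩK hΩp hBDP htors f hfI
    obtain ⟨-, hle⟩ := two_mul_valuation_le_of_norm_constantCoeff_le 3 hf0 hle1 u hval'
    have hc0' : (Dt.c : ℚ_[3]) ≠ 0 := by exact_mod_cast hc0
    rw [div_eq_mul_inv, Padic.valuation_mul hlog (inv_ne_zero hc0'), Padic.valuation_inv,
      Padic.valuation_intCast, valuation_logOmega hlog, hfn] at hle
    refine ⟨n, ⟨htors, f, hfI, hf0, hfn⟩, ?_⟩
    simp only [padicValInt] at hle
    linarith
  have hlo : SchneiderFree.IndexLowerBoundLeAt W 3 K P (padicValNat 3 Dt.c.natAbs) :=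
    SchneiderFreeAdditiveX3.indexLowerBoundLeAt_of_imcLowerLe_of_control rfl hK hHN hfin hlow
      ⟨n, hn, hneq⟩
  -- the UPPER socket at slack `v₃(c)` IS the Kolyvagin crux (tower surjectivity, `d_K` odd, `≠ -3`)
  have hupI : SchneiderFree.Upper.IndexUpperBoundLeAt W 3 K P (padicValNat 3 Dt.c.natAbs) :=
    hKoly W (W.conductorNorm ℤ) K Dt H ι P hO6 hsurj hr rfl hK hHN hLt hP hnt hodd hd3 htower
  -- (c) TERMINAL STEP: a globally minimal model of the twist, then p528981
  have hD0 : (NumberField.discr K : ℚ) ≠ 0 := by exact_mod_cast NumberField.discr_ne_zero K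
  haveI : (W.quadraticTwist (NumberField.discr K : ℚ)).IsElliptic := W.isElliptic_quadraticTwist hD0
  obtain ⟨Cd, hCd⟩ := hasGlobalMinimalModel_rat_holds (W.quadraticTwist (NumberField.discr K : ℚ))
  haveI : (Cd • W.quadraticTwist (NumberField.discr K : ℚ)).IsGloballyMinimal := hCd
  exact SchneiderFree.Exact.bsdp_three_of_exactIndexManin_of_wAllExclAddWildRankZero hGZ hKo hGZK hmod
    hGZ73 hZ W hO6 hsurj hr (W.conductorNorm ℤ) K Dt H ι P
    (Cd • W.quadraticTwist (NumberField.discr K : ℚ)) rfl hK hodd hHN hLt hP ⟨Cd, rfl⟩ hlo hupI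

end Summit.BirchSwinnertonDyer.BirchSwinnertonDyer.Theorems.WildSplitEisensteinInclusionAtThreeValueAtOne

end
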